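import Mathlib
import HarnessLib
import Summits.HubbardSuperconductivity.HubbardSuperconductivity.Theorems.KLProgrammeKLRegimeTwoVolumeSourceProfileDefs

/-!
# Route `KLProgramme` — crux K3, VL child `KLRegimeVolumeLimitV17F2` (stmt-HubbardSuperconductivity-20440), skeleton «cauchy» v11: THE CHOICE OF THE SOURCE
# SCALE `t` (assembler kit for `stub_vl_towerData`; located «SRC-DEG2», cure (β) of plan g22 (R171); seat hubbard-kl-k3c4-p1 g15; `--supports` 20440)

Under cure (β) the data target is `∃ t ∈ (0,1], Nonempty (TowerDataTS β U μ t)` and the profile field is fed with the budgets `S₀ j (2m) + t·S₁ j (2m) + t²·S₂ j (2m)`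
(`…TowerTruncProfileBridgeS`), where the source families' budgets are the producer's `S_s j m = klSrcBudget P Q′ U A (j+1) s m = A (j+1) s · (if m ≤ 2 then 1 else
klWtBudget P Q′ U (j+1) m)` with `A` volume-free but otherwise FREE.  The assembler needs ONE `t`, the same at every scale `j ≤ n_β` (the rescaling must commute
with every step), making the source part of the degree-`≤ 2` budgets as small as the alive law requires.  This file is that elementary choice:

* **`exists_srcScale_mul_le`** — for finitely many scales `j ≤ J`, targets `τ j > 0` and sizes `B j ≥ 0` there is `t ∈ (0,1]` with `t · B j ≤ τ j` for all `j ≤ J`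
  (`t := min 1 (min_j τ j/(B j + 1))`);
* **`srcScaled_klSrcBudget_le`** — with `t · (A (j+1) 1 + A (j+1) 2) ≤ τ`, `0 ≤ t ≤ 1`, `A ≥ 0`: for every degree `m`,
  `t · klSrcBudget P Q′ U A (j+1) 1 m + t² · klSrcBudget P Q′ U A (j+1) 2 m ≤ τ · (if m ≤ 2 then 1 else klWtBudget P Q′ U (j+1) m)` — the source families enter the
  (H3) majorants with the alive-type law scaled by `τ`;
* `exists_srcScale_klSrcBudget_le` — both combined over `j ≤ J`.

Proofs only; no definition; elementary real inequalities. [cite: BenfattoGiulianiMastropietro2006, §2.9 (4.6)-(4.8)]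
-/

noncomputable section

namespace Summit.HubbardSuperconductivity.HubbardSuperconductivity.Theorems.TwoVolumeSource

set_option linter.dupNamespace false -- summit = problem name (single-conjunct summit), D-0017

open Finset
open Summit.HubbardSuperconductivity.HubbardSuperconductivity.Theorems.KLProgrammeLegKernels
open Summit.HubbardSuperconductivity.HubbardSuperconductivity.Theorems.KLRegimeSplit
open Summit.HubbardSuperconductivity.HubbardSuperconductivity.Theorems.EngineV8

/-- **One source scale for finitely many scales**: `∃ t ∈ (0,1]`, `t · B j ≤ τ j` for all `j ≤ J` (`τ j > 0`, `B j ≥ 0`). [folklore] -/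
theorem exists_srcScale_mul_le (J : ℕ) (τ B : ℕ → ℝ) (hτ : ∀ j, j ≤ J → 0 < τ j) (hB : ∀ j, j ≤ J → 0 ≤ B j) :
    ∃ t : ℝ, 0 < t ∧ t ≤ 1 ∧ ∀ j, j ≤ J → t * B j ≤ τ j := by
  classical
  have hne : (range (J + 1)).Nonempty := ⟨0, by simp⟩
  have hmem : ∀ j, j ≤ J → j ∈ range (J + 1) := fun j hj => mem_range.2 (Nat.lt_succ_of_le hj)
  have hmem' : ∀ j, j ∈ range (J + 1) → j ≤ J := fun j hj => Nat.le_of_lt_succ (mem_range.1 hj)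
  set t₀ : ℝ := (range (J + 1)).inf' hne (fun j => τ j / (B j + 1)) with ht₀
  refine ⟨min 1 t₀, lt_min one_pos ?_, min_le_left _ _, fun j hj => ?_⟩
  · rw [ht₀, Finset.lt_inf'_iff]
    intro j hj
    exact div_pos (hτ j (hmem' j hj)) (by linarith [hB j (hmem' j hj)])
  · have ht₀le : t₀ ≤ τ j / (B j + 1) := Finset.inf'_le _ (hmem j hj)
    have hB1 : 0 < B j + 1 := by linarith [hB j hj]
    calc min 1 t₀ * B j ≤ τ j / (B j + 1) * B j := mul_le_mul_of_nonneg_right ((min_le_right _ _).trans ht₀le) (hB j hj)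
      _ ≤ τ j / (B j + 1) * (B j + 1) := mul_le_mul_of_nonneg_left (by linarith) (div_nonneg (hτ j hj).le hB1.le)
      _ = τ j := div_mul_cancel₀ _ hB1.ne'

/-- **The rescaled source budgets below the alive-type law**: with `t · (A (j+1) 1 + A (j+1) 2) ≤ τ`, `0 ≤ t ≤ 1`, `A (j+1) 1, A (j+1) 2 ≥ 0` and the producer's
degree law nonnegative, `t · klSrcBudget … 1 m + t² · klSrcBudget … 2 m ≤ τ · (if m ≤ 2 then 1 else klWtBudget P Q′ U (j+1) m)` in every degree `m`
(only `A (j+1) 2 ≥ 0` is used: `t² ≤ t`).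
[cite: BenfattoGiulianiMastropietro2006, §2.9 (4.6)-(4.8)] -/
theorem srcScaled_klSrcBudget_le (P : SplitConsts) (Q' : EngConsts) (U : ℝ) (A : ℕ → ℕ → ℝ) (j : ℕ) {t τ : ℝ} (ht0 : 0 ≤ t) (ht1 : t ≤ 1)
    (hA2 : 0 ≤ A (j + 1) 2) (hτ : t * (A (j + 1) 1 + A (j + 1) 2) ≤ τ) (hW : ∀ m, 0 ≤ klWtBudget P Q' U (j + 1) m) (m : ℕ) :
    t * klSrcBudget P Q' U A (j + 1) 1 m + t ^ 2 * klSrcBudget P Q' U A (j + 1) 2 m ≤ τ * (if m ≤ 2 then 1 else klWtBudget P Q' U (j + 1) m) := by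
  have hw : 0 ≤ (if m ≤ 2 then (1 : ℝ) else klWtBudget P Q' U (j + 1) m) := by split_ifs; exacts [zero_le_one, hW m]
  have ht2 : t ^ 2 ≤ t := by nlinarith
  unfold klSrcBudget
  have h1 : t ^ 2 * (A (j + 1) 2 * (if m ≤ 2 then (1 : ℝ) else klWtBudget P Q' U (j + 1) m)) ≤
      t * (A (j + 1) 2 * (if m ≤ 2 then (1 : ℝ) else klWtBudget P Q' U (j + 1) m)) :=
    mul_le_mul_of_nonneg_right ht2 (mul_nonneg hA2 hw)
  calc t * (A (j + 1) 1 * (if m ≤ 2 then (1 : ℝ) else klWtBudget P Q' U (j + 1) m)) +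
        t ^ 2 * (A (j + 1) 2 * (if m ≤ 2 then (1 : ℝ) else klWtBudget P Q' U (j + 1) m))
      ≤ t * (A (j + 1) 1 * (if m ≤ 2 then (1 : ℝ) else klWtBudget P Q' U (j + 1) m)) +
        t * (A (j + 1) 2 * (if m ≤ 2 then (1 : ℝ) else klWtBudget P Q' U (j + 1) m)) := by linarith
    _ = t * (A (j + 1) 1 + A (j + 1) 2) * (if m ≤ 2 then (1 : ℝ) else klWtBudget P Q' U (j + 1) m) := by ring
    _ ≤ τ * (if m ≤ 2 then (1 : ℝ) else klWtBudget P Q' U (j + 1) m) := mul_le_mul_of_nonneg_right hτ hw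

/-- **The source scale of the tower**: for the producer's volume-free `A ≥ 0` (degree `≤ 2` families) and positive targets `τ j`, `j ≤ J`, ONE `t ∈ (0,1]` puts
the rescaled source budgets below `τ j ·` (alive-type law) at every scale `j ≤ J` and in every degree. [cite: BenfattoGiulianiMastropietro2006, §2.9 (4.6)-(4.8)] -/
theorem exists_srcScale_klSrcBudget_le (P : SplitConsts) (Q' : EngConsts) (U : ℝ) (A : ℕ → ℕ → ℝ) (J : ℕ) (τ : ℕ → ℝ)
    (hτ : ∀ j, j ≤ J → 0 < τ j) (hA : ∀ j s, j ≤ J → 1 ≤ s → s ≤ 2 → 0 ≤ A (j + 1) s) (hW : ∀ j m, 0 ≤ klWtBudget P Q' U (j + 1) m) :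
    ∃ t : ℝ, 0 < t ∧ t ≤ 1 ∧ ∀ j, j ≤ J → ∀ m : ℕ,
      t * klSrcBudget P Q' U A (j + 1) 1 m + t ^ 2 * klSrcBudget P Q' U A (j + 1) 2 m ≤ τ j * (if m ≤ 2 then 1 else klWtBudget P Q' U (j + 1) m) := by
  obtain ⟨t, ht0, ht1, hle⟩ := exists_srcScale_mul_le J τ (fun j => A (j + 1) 1 + A (j + 1) 2) hτ
    (fun j hj => add_nonneg (hA j 1 hj le_rfl (by norm_num)) (hA j 2 hj (by norm_num) le_rfl))
  exact ⟨t, ht0, ht1, fun j hj m => srcScaled_klSrcBudget_le P Q' U A j ht0.le ht1 (hA j 2 hj (by norm_num) le_rfl) (hle j hj) (hW j) m⟩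

end Summit.HubbardSuperconductivity.HubbardSuperconductivity.Theorems.TwoVolumeSource

end
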